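import Summits.CriticalPhenomena.PercolationContinuityZ3.Theorems.Transplant.SkelNegBParamsRootValsY
import Summits.CriticalPhenomena.PercolationContinuityZ3.Theorems.Transplant.SkelNegBParamsRootValsA
import HarnessLib

/-!
# N1 params, chain of record `NegB`, part RootValsY-A — the (ζ′) twin of part RootValsY §2 at `A := Aof κ`: THE y′-ORIGIN's FINE ORDINATE
# **`KS.F1cA y := coarse c₁ (D_A/2) D_A (lam1 A n_L h_L y)`** with **`F1cA_eq : F1cA y = (2·u₁A·Λ₁(y) + m)/(2m)`**, and THE y′-STRIDE COUNT
# **`KS.NyOfA σ' y := round((800·Kq·u₁A − σ'·F1cA)/u₁A) − 1`** with **`NyOfA_spec : 1+3+1+NyOfA ≤ 1000·Kq ∧ |F1cA + σ'·u₁A·(NyOfA+1) − σ'·800·Kq·u₁A| ≤ u₁A`**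
# (stmt-g16 2026-08-22; the window data `sLoY/sHiY/LaY/qY`, the shifts `Δ0/Δ1/ρY/yYof`, the boxes and the origin relations of part RootValsY are cell-free, reused)
builds on p205010 (kernel theorem, internal audit signed; external expert review pending) — nothing in this file uses p205010; NOTHING is claimed about the node
`SamePDropOfSkeletonNeg₁` (OPEN).
Lane `prim-bschramm-*`, seat `prim-bschramm-stmt` (gen 16); helper file (`--supports stmt-CriticalPhenomena-4575 --as helper`); ledger HOME/prim-bschramm-stmt/NEG-PARAMS.md.
[cite: KozmaNitzan2024, §4 p. 28 ((32) at the root), Lemma 11 (p. 22)] [cite: MartineauTassion2017, §3.2 (top pieces), §4.3 Lemma 4.2]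
-/

noncomputable section

open scoped Classical

namespace Summit.CriticalPhenomena.PercolationContinuityZ3.Theorems.Transplant

namespace PlanarSkeletonNeg

namespace NegB

open Literature.Probability.Percolation Literature.Probability.LatticeModels SimpleGraph
open SkelConc (Consts)
open Skelφ.StepI (DataN)
open TwoAxis.Para (modulus)
open Neg

namespace KS

section Count

variable (κ : Consts) {V : Type} [DecidableEq V] [Countable V] {G : SimpleGraph V} [G.LocallyFinite] (Φ : PlanarSkeletonNeg G) (t : V)
  (p : unitInterval) (D : DataN V) (g f : ℕ)

/-- **The y′-origin's fine ordinate of the (ζ′) chain** `F1cA(y) := coarse c₁ (D_A/2) D_A (lam1 A n_L h_L y)` (p3's literal over `prFA`). [this work] -/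
def F1cA (y : Site 2) : ℤ :=
  TwoAxis.Para.coarse (20 * ((fcellsA κ Φ t p D g f).K : ℤ) * (((fcellsA κ Φ t p D g f).s 1 : ℕ) : ℤ))
    (Skelφ.NegPrm.DofA (Aof κ) (nL κ Φ t p D g f) (hL κ Φ t p D g f) (ℓL κ Φ t p D g f) (vL κ Φ t p D g f) / 2)
    (Skelφ.NegPrm.DofA (Aof κ) (nL κ Φ t p D g f) (hL κ Φ t p D g f) (ℓL κ Φ t p D g f) (vL κ Φ t p D g f))
    (TwoAxis.Para.lam1 (Aof κ) (nL κ Φ t p D g f : ℤ) (hL κ Φ t p D g f) y)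

/-- `F1cA(y)` in the literal RootArith-A shape. [folklore] -/
theorem F1cA_eq_lit (y : Site 2) : F1cA κ Φ t p D g f y =
    (Aof κ * u₁A κ Φ t p D g f * (Aof κ * Λ₁of κ Φ t p D g f y) +
        (Aof κ) ^ 2 * modulus (nL κ Φ t p D g f) (hL κ Φ t p D g f) (vL κ Φ t p D g f) (Skelφ.NegPrm.vβOf (nL κ Φ t p D g f) (hL κ Φ t p D g f) (ℓL κ Φ t p D g f) (vL κ Φ t p D g f)) / 2) /
      ((Aof κ) ^ 2 * modulus (nL κ Φ t p D g f) (hL κ Φ t p D g f) (vL κ Φ t p D g f) (Skelφ.NegPrm.vβOf (nL κ Φ t p D g f) (hL κ Φ t p D g f) (ℓL κ Φ t p D g f) (vL κ Φ t p D g f))) := by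
  unfold F1cA TwoAxis.Para.coarse
  rw [(units_eqA κ Φ t p D g f).2.1, DofA_eq', (lam_eqA κ Φ t p D g f y).2]

/-- **`F1cA(y) = (2·u₁A·Λ₁(y) + m)/(2m)`** (`A = 20K` is even and cancels). [folklore] -/
theorem F1cA_eq (y : Site 2) : F1cA κ Φ t p D g f y =
    (2 * u₁A κ Φ t p D g f * Λ₁of κ Φ t p D g f y + modulus (nL κ Φ t p D g f) (hL κ Φ t p D g f) (vL κ Φ t p D g f) (vβL κ Φ t p D g f)) /
      (2 * modulus (nL κ Φ t p D g f) (hL κ Φ t p D g f) (vL κ Φ t p D g f) (vβL κ Φ t p D g f)) := by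
  have hAe : 2 ∣ Aof κ := ⟨10 * (Neg.K κ : ℤ), by rw [Aof_eq_K]; ring⟩
  unfold F1cA TwoAxis.Para.coarse
  rw [(units_eqA κ Φ t p D g f).2.1, DofA_eq', (lam_eqA κ Φ t p D g f y).2]
  exact RootArithA.coarse_cancel (Aof_pos κ).1 hAe

/-- **THE y′-STRIDE COUNT OF THE (ζ′) CHAIN** `NyOfA := round((800·Kq·u₁A − σ'·F1cA)/u₁A) − 1`. [this work] -/
def NyOfA (σ : ℤ) (y : Site 2) : ℕ :=
  Int.toNat ((800 * (Neg.Kq κ : ℤ) * u₁A κ Φ t p D g f - σ * F1cA κ Φ t p D g f y + u₁A κ Φ t p D g f / 2) / u₁A κ Φ t p D g f - 1)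

/-- **The (ζ′) y′-stride count is admissible and centred**: `1 + 3 + 1 + NyOfA ≤ 1000·Kq` and `|F1cA + σ'·u₁A·(NyOfA+1) − σ'·800·Kq·u₁A| ≤ u₁A` whenever `|Λ₁(y)| ≤ 3m`.
[folklore] -/
theorem NyOfA_spec (hN : EqNumL κ Φ t p D g f) {σ : ℤ} (hσ : σ = 1 ∨ σ = -1) (y : Site 2)
    (hΛ : |Λ₁of κ Φ t p D g f y| ≤ 3 * modulus (nL κ Φ t p D g f) (hL κ Φ t p D g f) (vL κ Φ t p D g f) (vβL κ Φ t p D g f)) :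
    0 + 1 + 3 + 1 + NyOfA κ Φ t p D g f σ y ≤ 1000 * Neg.Kq κ ∧
      |F1cA κ Φ t p D g f y + σ * u₁A κ Φ t p D g f * ((NyOfA κ Φ t p D g f σ y : ℤ) + 1) - σ * (800 * (Neg.Kq κ : ℤ)) * u₁A κ Φ t p D g f| ≤ u₁A κ Φ t p D g f := by
  obtain ⟨hn1, hℓ1⟩ := one_le_of_eqNumL κ Φ t p D g f hN
  have hm : 0 < modulus (nL κ Φ t p D g f) (hL κ Φ t p D g f) (vL κ Φ t p D g f) (vβL κ Φ t p D g f) := Skelφ.NegPrm.modulus_vβOf_pos hn1 hℓ1 _ _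
  have hu : 1 ≤ u₁A κ Φ t p D g f := (units_eqA κ Φ t p D g f).2.2.2.2.2.2.2
  have hq : (1 : ℤ) ≤ Neg.Kq κ := by exact_mod_cast Neg.one_le_Kq κ
  have hF := F1cA_eq κ Φ t p D g f y
  obtain ⟨f1, f2⟩ := RootArith.floor_sandwich (x := 2 * u₁A κ Φ t p D g f * Λ₁of κ Φ t p D g f y + modulus (nL κ Φ t p D g f) (hL κ Φ t p D g f) (vL κ Φ t p D g f) (vβL κ Φ t p D g f))
    (d := 2 * modulus (nL κ Φ t p D g f) (hL κ Φ t p D g f) (vL κ Φ t p D g f) (vβL κ Φ t p D g f)) (by linarith)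
  rw [← hF] at f1 f2
  set F := F1cA κ Φ t p D g f y
  set u := u₁A κ Φ t p D g f
  set Q := (Neg.Kq κ : ℤ)
  set m := modulus (nL κ Φ t p D g f) (hL κ Φ t p D g f) (vL κ Φ t p D g f) (vβL κ Φ t p D g f)
  obtain ⟨hΛ1, hΛ2⟩ := abs_le.1 hΛ
  have huΛlo : u * (-(3 * m)) ≤ u * Λ₁of κ Φ t p D g f y := mul_le_mul_of_nonneg_left hΛ1 (by linarith)
  have huΛhi : u * Λ₁of κ Φ t p D g f y ≤ u * (3 * m) := mul_le_mul_of_nonneg_left hΛ2 (by linarith)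
  have hFlo : -3 * u ≤ F := by
    by_contra hc; push Not at hc
    have h1 : 2 * m * F ≤ 2 * m * (-3 * u - 1) := mul_le_mul_of_nonneg_left (by linarith) (by linarith)
    nlinarith
  have hFhi : F ≤ 3 * u := by
    by_contra hc; push Not at hc
    have h1 : 2 * m * (3 * u + 1) ≤ 2 * m * F := mul_le_mul_of_nonneg_left (by linarith) (by linarith)
    nlinarith
  obtain ⟨d1, d2⟩ := RootArith.floor_sandwich (x := u) (d := 2) (by norm_num)
  have hu0 : 0 < u := by linarith
  obtain ⟨x1, x2⟩ := RootArith.floor_sandwich (x := 800 * Q * u - σ * F + u / 2) (d := u) hu0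
  set X := (800 * Q * u - σ * F + u / 2) / u
  have hσF : |σ * F| ≤ 3 * u := by
    rcases hσ with rfl | rfl
    · rw [one_mul]; exact abs_le.2 ⟨by linarith, hFhi⟩
    · rw [neg_one_mul, abs_neg]; exact abs_le.2 ⟨by linarith, hFhi⟩
  obtain ⟨s1, s2⟩ := abs_le.1 hσF
  have hQu : u ≤ Q * u := by nlinarith
  have hXlo : 800 * Q - 4 ≤ X := by
    by_contra hc; push Not at hc
    have : u * X ≤ u * (800 * Q - 5) := mul_le_mul_of_nonneg_left (by linarith) hu0.le
    nlinarith
  have hXhi : X ≤ 800 * Q + 4 := by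
    by_contra hc; push Not at hc
    have : u * (800 * Q + 5) ≤ u * X := mul_le_mul_of_nonneg_left (by linarith) hu0.le
    nlinarith
  have hNr : (NyOfA κ Φ t p D g f σ y : ℤ) = X - 1 := by
    show (Int.toNat ((800 * Q * u - σ * F + u / 2) / u - 1) : ℤ) = X - 1
    rw [Int.toNat_of_nonneg (by linarith)]
  constructor
  · have : ((0 + 1 + 3 + 1 + NyOfA κ Φ t p D g f σ y : ℕ) : ℤ) ≤ ((1000 * Neg.Kq κ : ℕ) : ℤ) := by push_cast; rw [hNr]; linarith
    exact_mod_cast this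
  · rw [hNr, abs_le]
    have e : u * X = u * (X - 1 + 1) := by ring
    rcases hσ with rfl | rfl
    · simp only [one_mul] at x1 x2 ⊢
      constructor <;> linarith
    · simp only [neg_mul, one_mul, sub_neg_eq_add] at x1 x2 ⊢
      constructor <;> linarith

/-- **hp-8's schedule-index room `hnFy`** at the (ζ′) count: `0 + 1 + 3 + 1 + NyOfA + 1 + N₃ ≤ nFA κ.K₀` for any `N₃ ≤ 995·Kq`. [folklore] -/
theorem hnFy_RA (hN : EqNumL κ Φ t p D g f) {σ : ℤ} (hσ : σ = 1 ∨ σ = -1) (y : Site 2)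
    (hΛ : |Λ₁of κ Φ t p D g f y| ≤ 3 * modulus (nL κ Φ t p D g f) (hL κ Φ t p D g f) (vL κ Φ t p D g f) (vβL κ Φ t p D g f))
    {N₃ : ℕ} (hN₃ : N₃ ≤ 995 * Neg.Kq κ) : 0 + 1 + 3 + 1 + NyOfA κ Φ t p D g f σ y + 1 + N₃ ≤ nFA κ.K₀ := by
  have h1 := (NyOfA_spec κ Φ t p D g f hN hσ y hΛ).1
  rw [(nFA_le_LfA κ.K₀).2, LfA_eq]
  omega

end Count

end KS

end NegB

end PlanarSkeletonNeg

end Summit.CriticalPhenomena.PercolationContinuityZ3.Theorems.Transplant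

end
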